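import Summits.BirchSwinnertonDyer.Rank1Residual.GaloisImage.SupersingularTwistNonsplitCartan
import HarnessLib

/-!
# BSD rank-≤1 residual cell: the dihedral field of a non-split Cartan image is IMAGINARY
# (complex conjugation lies outside `U = ρ̄⁻¹(kˣ)`), at a good supersingular prime and on its twists

HONEST FRAMING (cell `b2b-bsdres-*`, run/shared/lean/b2b/bsd-rank1-residual/, verbatim): the goal
of the cell is to DELETE the COMBINATION-SHAPED residual classes for ALL analytic-rank `≤ 1` elliptic
curves over `ℚ` — "full BSD formula for every rank `≤ 1` curve in class C" assembled STRICTLY from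
published theorems — so that the rank-`≤ 1` remainder becomes exactly the CONSTRUCTION-SHAPED
classes, which are TYPED (missing-input Props), NOT attempted; this is not "finishing BSD".
No claim beyond stated classes; census output = EVIDENCE, never a Literature fact.  Unit
`b2b-bsdres-n1011-p04-g2` (team n1011, O8 image strand, row T-O8c, structural note for
`cells/n1011/O8-IDEATION.md`).  THEOREMS ONLY (no definition, no named fact, no binder).

## What this file does

When the image of `ρ̄_{E,p}` normalises a non-split Cartan subgroup `kˣ` without lying in it, the
subgroup `U = ρ̄⁻¹(Φ⁻¹(kˣ)) ≤ Γ_ℚ` has index `2` and cuts out a quadratic field `M` with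
`ρ̄ ≅ Ind_M^ℚ ψ` (this unit: `exists_index_two_subgroup_of_goodSS_of_not_surj` — `M` is unramified at
`p` and at every semistable place).  Here: **`M` is IMAGINARY** — every complex conjugation
`c ∈ Γ_ℚ` lies OUTSIDE `U`, because `ρ̄(c)` has eigenvalues `{1, -1}` (`c² = 1`, `det ρ̄(c) =
χ̄_p(c) = -1`, §5.2 (iv)) and a field `k` contains no such element (in a field `x² = 1 ⇒ x = ±1`;
tree `not_mem_unitGroup_of_mul_self_eq_one`).  This is the datum the Heegner / anticyclotomic
methods of the joint N2/N3/O8 ideation target care about (the auxiliary imaginary quadratic `K`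
must be compared with `M`: for `K = M` the restriction `ρ̄|_{G_K} = ψ ⊕ ψ'` is reducible).

* `not_mem_comap_unitGroup_of_sq_eq_one_of_cyclotomic_eq_neg_one` — for ANY curve, frame and
  field `k ⊆ M₂(𝔽_p)` (`p ≠ 2`): an involution `σ` with `χ̄_p(σ) = -1` is not in `U`.
* `not_mem_comap_unitGroup_of_isComplexConjugation` — in particular no complex conjugation is.
* `exists_imaginary_index_two_subgroup_of_goodSS_of_not_surj` — **at a good supersingular `p ≠ 2`
  with `ρ̄` not onto: `U` is open of index `2`, contains the inertia above `p` and above every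
  good / multiplicative place, and contains NO complex conjugation** (`M` imaginary quadratic,
  unramified at `p` and at the semistable primes of `E`).
* `exists_imaginary_index_two_subgroup_of_goodSS_twist_of_not_surj` — the twist rows (O8 ∩ (G) ∧
  ss, `e = 2`): `U` open, index `2`, no complex conjugation (ramification data for the twist rows
  is not restated here).

What is NOT claimed: which imaginary quadratic field `M` is; anything about `ρ̄|_{G_K}` for `K ≠ M`
(irreducible — standard, not proved here); any class theorem.

## References

* [Serre1972] J.-P. Serre, Invent. Math. 15 (1972), §5.2 (iv) ("`φ_l(G)` n'est pas contenu dans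
  un sous-groupe de Cartan non déployé"), §2.2, §4.2 c).
-/

noncomputable section

open scoped Classical NumberField
open Matrix Field WeierstrassCurve IsDedekindDomain NumberField Literature.NumberTheory.EllipticCurves
  Literature.NumberTheory.GaloisRepresentations Literature.NumberTheory.GaloisRepresentations.Serre1972
  Literature.NumberTheory.EllipticCurves.Rank1Residual

namespace Summit.BirchSwinnertonDyer.Rank1Residual.GaloisImage

variable (W : WeierstrassCurve ℚ) [W.IsElliptic] (p : ℕ) [hp : Fact p.Prime]
  (Φ : Multiplicative (AddAut (geomTorsion W p)) ≃* GL (Fin 2) (ZMod p))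
  (e : geomTorsion W p ≃+ (Fin 2 → ZMod p))
  (he : ∀ (g : Multiplicative (AddAut (geomTorsion W p))) (x : geomTorsion W p),
    e (Multiplicative.toAdd g x) =
      ((Φ g : GL (Fin 2) (ZMod p)) : Matrix (Fin 2) (Fin 2) (ZMod p)) *ᵥ e x)

include he in
/-- **An involution with cyclotomic character `-1` is never in `U = ρ̄⁻¹(Φ⁻¹(kˣ))`** (`k ⊆ M₂(𝔽_p)`
a subalgebra which is a field, `p ≠ 2`, ANY curve): `Φ(ρ̄ σ)` squares to `1` and has determinant
`χ̄_p(σ) = -1` (`det_frame_galoisRepTorsion_eq`), so it is non-scalar with eigenvalues `±1`, and a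
field contains no such element (`not_mem_unitGroup_of_mul_self_eq_one`). [cite: Serre1972, §5.2 (iv)] -/
theorem not_mem_comap_unitGroup_of_sq_eq_one_of_cyclotomic_eq_neg_one (hp2 : p ≠ 2)
    {k : Subalgebra (ZMod p) (Matrix (Fin 2) (Fin 2) (ZMod p))} (hk : IsField k)
    {σ : absoluteGaloisGroup ℚ} (hσ : σ ^ 2 = 1)
    (hχ : haveI : NeZero (p : ℚ) := ⟨by exact_mod_cast hp.out.ne_zero⟩
      ((modPCyclotomicCharacterZMod ℚ p σ : (ZMod p)ˣ) : ZMod p) = -1) :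
    σ ∉ ((unitGroup k).comap Φ.toMonoidHom).comap (galoisRepTorsion W p) := by
  haveI : NeZero (p : ℚ) := ⟨by exact_mod_cast hp.out.ne_zero⟩
  intro hmem
  rw [mem_comap_cartan_iff] at hmem
  have hc : Φ (galoisRepTorsion W p σ) * Φ (galoisRepTorsion W p σ) = 1 := by
    rw [← map_mul, ← map_mul, ← sq, hσ, map_one, map_one]
  have hdet : Matrix.det ((Φ (galoisRepTorsion W p σ) : GL (Fin 2) (ZMod p)) :
      Matrix (Fin 2) (Fin 2) (ZMod p)) = -1 := by
    rw [det_frame_galoisRepTorsion_eq W p e Φ he σ, hχ]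
  exact not_mem_unitGroup_of_mul_self_eq_one hk hc
    (ne_smul_one_of_mul_self_eq_one_of_det_eq_neg_one
      (DeligneSerre1974.two_ne_zero_of_ne_two hp2) hc hdet) hmem

include he in
/-- **No complex conjugation lies in `U = ρ̄⁻¹(Φ⁻¹(kˣ))`** (`p ≠ 2`, `k` a field, any curve): a
complex conjugation `c` (`IsComplexConjugation (Rat.castHom ℝ) c`) is an involution with
`χ̄_p(c) = -1` (`modNCyclotomicCharacter_of_isComplexConjugation`).  So whenever `U` has index `2`
its fixed field is an IMAGINARY quadratic field. [cite: Serre1972, §5.2 (iv)] -/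
theorem not_mem_comap_unitGroup_of_isComplexConjugation (hp2 : p ≠ 2)
    {k : Subalgebra (ZMod p) (Matrix (Fin 2) (Fin 2) (ZMod p))} (hk : IsField k)
    {c : absoluteGaloisGroup ℚ} (hc : IsComplexConjugation (Rat.castHom ℝ) c) :
    c ∉ ((unitGroup k).comap Φ.toMonoidHom).comap (galoisRepTorsion W p) := by
  haveI : NeZero (p : ℚ) := ⟨by exact_mod_cast hp.out.ne_zero⟩
  haveI : NeZero p := ⟨hp.out.ne_zero⟩
  refine not_mem_comap_unitGroup_of_sq_eq_one_of_cyclotomic_eq_neg_one W p Φ e he hp2 hk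
    hc.sq_eq_one ?_
  rw [modPCyclotomicCharacterZMod_eq_modNCyclotomicCharacter]
  exact modNCyclotomicCharacter_of_isComplexConjugation hc

include he in
/-- **The dihedral field of a non-surjective good supersingular prime is an IMAGINARY quadratic field
unramified at `p` and at the semistable primes.**  At a good supersingular `p ≠ 2` (`W` globally
minimal) with `ρ̄_{E,p}` not onto there is a field `k ⊆ M₂(𝔽_p)` of degree `2` such that
`U = ρ̄⁻¹(Φ⁻¹(kˣ))` is open of index `2`, contains the inertia groups above `p` and above every
place of good or multiplicative reduction (this unit's `exists_index_two_subgroup_of_goodSS_of_not_surj`),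
and contains NO complex conjugation. [cite: Serre1972, §4.2 c), §2.2, §5.2 (iv)] -/
theorem exists_imaginary_index_two_subgroup_of_goodSS_of_not_surj [W.IsGloballyMinimal]
    (hp2 : p ≠ 2) (hss : GoodSS W p) (hns : ¬ Surj W p) :
    ∃ k : Subalgebra (ZMod p) (Matrix (Fin 2) (Fin 2) (ZMod p)), IsField k ∧
      Module.finrank (ZMod p) k = 2 ∧
      (galoisRepTorsion W p).range.map Φ.toMonoidHom ≤
          Subgroup.normalizer (unitGroup k : Set (GL (Fin 2) (ZMod p))) ∧
      IsOpen ((((unitGroup k).comap Φ.toMonoidHom).comap (galoisRepTorsion W p) :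
          Subgroup (absoluteGaloisGroup ℚ)) : Set (absoluteGaloisGroup ℚ)) ∧
      (((unitGroup k).comap Φ.toMonoidHom).comap (galoisRepTorsion W p)).index = 2 ∧
      (∀ v : HeightOneSpectrum (𝓞 ℚ),
        ((p : 𝓞 ℚ) ∈ v.asIdeal ∨ W.HasGoodReductionAt v ∨ W.HasMultiplicativeReductionAt v) →
        ∀ 𝔔 ∈ v.primesAbove,
          𝔔.inertia (absoluteGaloisGroup ℚ) ≤
            ((unitGroup k).comap Φ.toMonoidHom).comap (galoisRepTorsion W p)) ∧
      (∀ c : absoluteGaloisGroup ℚ, IsComplexConjugation (Rat.castHom ℝ) c →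
        c ∉ ((unitGroup k).comap Φ.toMonoidHom).comap (galoisRepTorsion W p)) := by
  obtain ⟨k, hk, h2, hGN, -, hopen, hidx, hin⟩ :=
    exists_index_two_subgroup_of_goodSS_of_not_surj W p Φ e he hp2 hss hns
  exact ⟨k, hk, h2, hGN, hopen, hidx, hin,
    fun c hc ↦ not_mem_comap_unitGroup_of_isComplexConjugation W p Φ e he hp2 hk hc⟩

include he in
/-- **Twist rows (O8 ∩ (G) ∧ ss, `e = 2`): the dihedral field is imaginary too.**  If a quadratic
twist model `Wd` of `E` (`C • W.quadraticTwist d = Wd`, `d ≠ 0`, globally minimal) has good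
supersingular reduction at `p ≠ 2` and `ρ̄_{E,p}` is not onto, then for the non-split Cartan
subgroup `kˣ` normalised by the image of `E` (p251588), `U = ρ̄_E⁻¹(Φ⁻¹(kˣ))` is open of index `2`
and contains no complex conjugation. [cite: Serre1972, §4.2 c), §5.2 (iv)]
[cite: SilvermanAEC2009, X.5 Cor. 5.4] -/
theorem exists_imaginary_index_two_subgroup_of_goodSS_twist_of_not_surj (hp2 : p ≠ 2) {d : ℚ}
    (hd : d ≠ 0) (Wd : WeierstrassCurve ℚ) [Wd.IsElliptic] [Wd.IsGloballyMinimal]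
    (hWd : ∃ C : VariableChange ℚ, C • W.quadraticTwist d = Wd) (hss : GoodSS Wd p)
    (hns : ¬ Surj W p) :
    ∃ k : Subalgebra (ZMod p) (Matrix (Fin 2) (Fin 2) (ZMod p)), IsField k ∧
      Module.finrank (ZMod p) k = 2 ∧
      (galoisRepTorsion W p).range.map Φ.toMonoidHom ≤
          Subgroup.normalizer (unitGroup k : Set (GL (Fin 2) (ZMod p))) ∧
      IsOpen ((((unitGroup k).comap Φ.toMonoidHom).comap (galoisRepTorsion W p) :
          Subgroup (absoluteGaloisGroup ℚ)) : Set (absoluteGaloisGroup ℚ)) ∧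
      (((unitGroup k).comap Φ.toMonoidHom).comap (galoisRepTorsion W p)).index = 2 ∧
      (∀ c : absoluteGaloisGroup ℚ, IsComplexConjugation (Rat.castHom ℝ) c →
        c ∉ ((unitGroup k).comap Φ.toMonoidHom).comap (galoisRepTorsion W p)) := by
  obtain ⟨k, hk, h2, hGN, hGC⟩ :=
    exists_le_normalizer_unitGroup_of_goodSS_twist_of_not_surj W p Φ e he Wd hp2 hd hWd hss hns
  have hC : unitGroup k ∈ cartanSubgroups (ZMod p) := unitGroup_mem_cartanSubgroups hk h2
  have hCp : (∃ P : GL (Fin 2) (ZMod p), unitGroup k = splitCartan P) → p ≠ 2 := fun _ ↦ hp2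
  exact ⟨k, hk, h2, hGN, isOpen_comap_cartan W p Φ, index_comap_cartan_eq_two W p Φ hC hCp hGN hGC,
    fun c hc ↦ not_mem_comap_unitGroup_of_isComplexConjugation W p Φ e he hp2 hk hc⟩

end Summit.BirchSwinnertonDyer.Rank1Residual.GaloisImage

end
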